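import Summits.QuantumAdvantage.AdviceFreeQNC0.AdviceFreeQNC0
import Summits.QuantumAdvantage.AdviceFreeQNC0.WalkCoordinates
import HarnessLib

/-!
# Cell qa-qnc0 (odd-prime rung, ROUND-12 §B): the ring crux on the ODD class, and `RingHardOdd p → RingHard p`

Planner qa-qnc0-p2 g12, `Sketch12b.lean` §7 (ROUND-12 §B.3), statements VERBATIM: `OddZeros` (the pattern has an
odd number of `X`-measurements — the transposition class of the `S₃`-monodromy, exactly half of all patterns),
**`RingHardOdd p`** (the ring crux restricted to the odd class: polylog-degree `𝔽_p`-polynomial maps satisfy the ring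
relation on at most `θ·2^{n-1}` odd patterns — for `p = 2` this is what `WalkTransport.ringHard_two_of_walkHard`
proves on the way; for odd `p` it is the cell's candidate first statement) and **P7 `RingHardOfOdd p`**, with the proof

* `ringHardOfOdd : RingHardOfOdd p` for EVERY prime `p` — give away the even class: the patterns with an even number
  of zeros are at most `2^{n-1}` of the `2^n` (`card_even_class_le`, `WalkCoordinates.lean`), so
  `RingHardOdd p` with threshold `θ` gives `RingHard p` with threshold `(1 + θ)/2`.

With the landed bridge (`RingFrameBridge.adviceFreeQNC0Sep_of_ringHard`, every prime) this makes `RingHardOdd p` a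
sufficient condition for the advice-free separation `AdviceFreeQNC0Sep p` (Sketch12b `ladder_odd`; not restated here to
keep this topic file independent of the route file).
(The withdrawn conjecture `RingHardOddHalf` — sharp constant `1/2` — is NOT typed: planner qa-qnc0-p1 g15 killed it,
the one-flip strategy wins on `→ 2/3` of the odd class for every `p`.)

WHAT THIS IS NOT: no hardness is proved here for odd `p` (`RingHardOdd p` is OPEN for `p ≥ 3`); separation NOT moved.
-/

namespace Summit.QuantumAdvantage.AdviceFreeQNC0

open Finset
open Literature.Computability.QuantumComplexity Literature.Computability.MetaComplexity

/-! ### Statements (qa-qnc0-p2 Sketch12b §7 — verbatim) -/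

/-- `OddZeros x`: the pattern has an odd number of `X`-measurements (`x_b = 0`), i.e. the monodromy
of the transfer matrices `M(x_b) = [[0,1],[1,x_b]] ∈ GL₂(𝔽₂) ≅ S₃` is a transposition and
`dim K(x) = 1` (ROUND-11 §8.3 dictionary; census: exactly half of all patterns). (Sketch12b §7, verbatim.) -/
def OddZeros {n : ℕ} (x : Fin n → Bool) : Prop := (univ.filter fun b : Fin n => x b = false).card % 2 = 1

/-- **F-Q2-odd(p) `RingHardOdd p`** (Sketch12b §7, verbatim) — the ring crux ON THE ODD CLASS (one parity constraint
`⟨v*(x), z⟩ ≡ ℓ_x(v*(x))` per pattern): polylog-degree `𝔽_p`-polynomial maps satisfy it on at most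
`θ·2^{n-1}` of the `2^{n-1}` odd patterns.  For `p = 2` this is what
`WalkTransport.ringHard_two_of_walkHard` proves on the way (the even class is given away); for odd
`p` it is the cell's candidate FIRST STATEMENT (not in print; GK 2024 §1.3 asks the circuit question). -/
def RingHardOdd (p : ℕ) [Fact p.Prime] : Prop :=
  open scoped Classical in
  ∃ θ : ℝ, θ < 1 ∧ ∀ c : ℕ, ∃ n₀ : ℕ, ∀ n ≥ n₀,
    ∀ P : Fin n → Smolensky.CubeFn (ZMod p) n,
      (∀ i, P i ∈ Smolensky.lowDeg (ZMod p) n ((Nat.log 2 n) ^ c)) →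
      ((univ.filter fun x : Fin n → Bool =>
          OddZeros x ∧ RingHLF.Rel x (fun i => decide (P i x = 1))).card : ℝ) ≤ θ * (2 : ℝ) ^ (n - 1)

/-- **P7 `RingHardOfOdd p`** (Sketch12b §7, verbatim; S, any prime): give away the even class —
`RingHardOdd p → RingHard p` with `θ' = (1 + θ)/2`. -/
def RingHardOfOdd (p : ℕ) [Fact p.Prime] : Prop := RingHardOdd p → RingHard p

/-! ### P7: give away the even class -/

/-- **P7 `RingHardOfOdd p` — PROVED** for every prime `p`: the even class has at most `2^{n-1}` patterns
(`card_even_class_le`), so a `θ·2^{n-1}` bound on the odd class gives `((1 + θ)/2)·2^n` overall. -/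
theorem ringHardOfOdd (p : ℕ) [Fact p.Prime] : RingHardOfOdd p := by
  classical
  rintro ⟨θ, hθ, hh⟩
  refine ⟨(1 + θ) / 2, by linarith, fun c => ?_⟩
  obtain ⟨n₀, hn₀⟩ := hh c
  refine ⟨max n₀ 1, fun N hN P hP => ?_⟩
  obtain ⟨n, rfl⟩ : ∃ n, N = n + 1 := ⟨N - 1, by have := le_max_right n₀ 1; omega⟩
  have hodd := hn₀ (n + 1) (le_trans (le_max_left _ _) hN) P hP
  rw [Nat.add_sub_cancel] at hodd
  -- split the solved patterns by the parity of the number of zeros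
  set Sx := univ.filter fun x : Fin (n + 1) → Bool => RingHLF.Rel x (fun i => decide (P i x = 1)) with hSx
  have hsplit : Sx.card = (Sx.filter OddZeros).card + (Sx.filter fun x => ¬ OddZeros x).card :=
    (Finset.card_filter_add_card_filter_not _).symm
  have heven : (Sx.filter fun x => ¬ OddZeros x).card ≤ 2 ^ n := by
    refine le_trans (Finset.card_le_card ?_) card_even_class_le
    intro x hx
    rw [mem_filter] at hx ⊢
    exact ⟨mem_univ _, hx.2⟩
  have hoddS : ((Sx.filter OddZeros).card : ℝ) ≤ θ * 2 ^ n := by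
    refine le_trans ?_ hodd
    gcongr
    intro x hx
    rw [hSx, mem_filter, mem_filter] at hx
    rw [mem_filter]
    exact ⟨mem_univ _, hx.2, hx.1.2⟩
  have hS : (Sx.card : ℝ) ≤ 2 ^ n + θ * 2 ^ n := by
    have h1 : (Sx.card : ℝ) = ((Sx.filter OddZeros).card : ℝ) + ((Sx.filter fun x => ¬ OddZeros x).card : ℝ) := by
      rw [hsplit]; push_cast; ring
    have h2 : ((Sx.filter fun x => ¬ OddZeros x).card : ℝ) ≤ 2 ^ n := by exact_mod_cast heven
    linarith
  have hpow : (2 : ℝ) ^ (n + 1) = 2 * 2 ^ n := by ring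
  calc (Sx.card : ℝ) ≤ 2 ^ n + θ * 2 ^ n := hS
    _ = (1 + θ) / 2 * (2 : ℝ) ^ (n + 1) := by rw [hpow]; ring

end Summit.QuantumAdvantage.AdviceFreeQNC0
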